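import Literature.Probability.LatticeModels.TemperleyLiebLinkPatterns
import Mathlib.Data.Fintype.Basic
import Mathlib.Data.Fintype.Pi
import Mathlib.Data.Fintype.Prod
import Mathlib.Data.Fintype.Sigma
import Mathlib.Data.Fintype.Sum
import Mathlib.Data.Finset.Card
import Mathlib.Tactic.DeriveFintype
import Mathlib.Algebra.BigOperators.Group.Finset.Basic
import HarnessLib

/-!
# Dilute link states with defects (bases of the standard modules of the dilute Temperley–Lieb algebra)

First layer of the definition request `defn-HexONTransferMatrix` (route
`CriticalPhenomena/SAWScalingLimit/SAWLatticeVirasoro`, items `KooSaleurVirasoro`, `ConformalTowers`;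
also the state space of the honeycomb `O(n)` / self-avoiding-walk strip transfer matrix of route
`SAWBetheAnsatz`). Source read: A. Morin-Duchesne, A. Klümper, P. A. Pearce, *Critical site
percolation on the triangular lattice: from integrability to conformal partition functions*,
J. Stat. Mech. (2023) 043103 = arXiv:2211.12379 [`MorinDuchesneKlumperPearce2023`], §3.3
("Standard modules. … Their vector spaces are spanned by link states on `N` nodes with `d` defects,
with `0 ≤ d ≤ N`. These are diagrams drawn above a segment with `N` marked nodes that are either
connected pairwise, occupied by a vertical segment called a defect, or left vacant"; the link states
of the strip algebra `dTL_N(β)` "may not" cross the boundary, i.e. they are planar; "If two defects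
are connected or if a loop segment is connected to a vacant site, the result is set to zero";
dimensions `dim V_{N,d} = (N choose d)₂ − (N choose d+2)₂` in trinomial coefficients), and
J. L. Jacobsen, *Conformal field theory applied to loop models*, in: Polygons, polyominoes and
polycubes, LNP 775 (2009), §14.7.2 ("a *state* … consists of *arcs* that connect pairs of points
within one time slice, and `ℓ` *strings*"; the number of strings labels the sectors of the transfer
matrix) [`Jacobsen2009`].

## Contents (namespace `Literature.Probability.LatticeModels`)

* `LinkSlot N` — the content of one node: `vac` (vacant), `defect` (a through-line / string), or
  `arc j` (paired with node `j`).
* `DiluteLink N` — **planar dilute link states on `N` nodes**: a slot assignment that is a partial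
  involution without fixed points on its arcs, NON-CROSSING, and with no defect enclosed by an arc
  (a string cannot escape a closed arc in the strip). `DecidableEq`, `Fintype` (noncomputable).
* API: `occ` (occupied nodes), `IsDefect`, `defectSet`, `defects` (the number of defects = the
  sector label `d`/`k`/`ℓ`), `arcSet` (arcs as ordered pairs `i < j`), `occSet`;
  the states `vacuum` (all vacant, `d = 0`), `full` (all defects, `d = N`), `single i` (one defect);
  `Sector N k` (the link states with exactly `k` defects, index type of the `k`-th diagonal block).
* `ofLinkPattern` — the dense, defect-free link patterns of `TemperleyLiebLinkPatterns.lean`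
  (`TemperleyLieb.LinkPattern`, all nodes occupied) are dilute link states with `0` defects.

## Not here

The dimension count (Motzkin-type numbers / trinomial formula of MDKP §3.3) is not proved. The
action of the dilute Temperley–Lieb generators and of the `A₂⁽²⁾` face operator on these states, and
the honeycomb `O(n)` column transfer matrix, are the follow-up files `DiluteFaceOperators.lean` and
`HexONTransferMatrix.lean` of the same request.
-/

namespace Literature.Probability.LatticeModels

open Finset

/-- The content of one node of a dilute link state: vacant, a defect (through-line), or the end of
an arc whose other end is the node `partner`. [cite: MorinDuchesneKlumperPearce2023, §3.3 (Standard modules)] -/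
inductive LinkSlot (N : ℕ) : Type
  | vac : LinkSlot N
  | defect : LinkSlot N
  | arc (partner : Fin N) : LinkSlot N
  deriving DecidableEq, Fintype

/-- **Planar dilute link states on `N` nodes** (the basis of the standard module `V_{N,d}` of the
dilute Temperley–Lieb algebra `dTL_N(β)`, all `d` together): every node is vacant, carries a defect,
or is paired with another node by an arc; arcs are symmetric and have two distinct ends; the
diagram is planar: no two arcs cross and no defect sits strictly inside an arc.
[cite: MorinDuchesneKlumperPearce2023, §3.3 (Standard modules)] -/
@[ext]
structure DiluteLink (N : ℕ) where
  /-- The content of each node. -/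
  slot : Fin N → LinkSlot N
  /-- Arcs are symmetric: if `i` is paired with `j` then `j` is paired with `i`. -/
  symm : ∀ ⦃i j : Fin N⦄, slot i = .arc j → slot j = .arc i
  /-- No node is paired with itself. -/
  irrefl : ∀ i : Fin N, slot i ≠ .arc i
  /-- Planarity: strictly inside an arc `i < j` there is no defect, and every arc starting there
  ends there. -/
  planar : ∀ ⦃i j : Fin N⦄, slot i = .arc j → i < j → ∀ ⦃k : Fin N⦄, i < k → k < j →
    slot k ≠ .defect ∧ ∀ ⦃l : Fin N⦄, slot k = .arc l → i < l ∧ l < j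

namespace DiluteLink

variable {N : ℕ}

/-- `slot` determines the link state. [folklore] -/
theorem slot_injective : Function.Injective (slot : DiluteLink N → Fin N → LinkSlot N) :=
  fun _ _ h => DiluteLink.ext h

/-- Equality of link states is decidable (compare the slot functions). [folklore] -/
instance instDecidableEq : DecidableEq (DiluteLink N) := fun σ τ =>
  decidable_of_iff (σ.slot = τ.slot) ⟨fun h => DiluteLink.ext h, fun h => h ▸ rfl⟩

/-- There are finitely many link states on `N` nodes. [folklore] -/
noncomputable instance instFintype : Fintype (DiluteLink N) :=
  Fintype.ofInjective slot slot_injective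

/-! ### Occupation, defects, arcs -/

/-- Node `i` is occupied (by a defect or an arc end). [cite: MorinDuchesneKlumperPearce2023, §3.3] -/
def occ (σ : DiluteLink N) (i : Fin N) : Prop := σ.slot i ≠ .vac

/-- Occupation is decidable. [folklore] -/
instance (σ : DiluteLink N) (i : Fin N) : Decidable (σ.occ i) :=
  inferInstanceAs (Decidable (σ.slot i ≠ .vac))

/-- Node `i` carries a defect (through-line). [cite: MorinDuchesneKlumperPearce2023, §3.3] -/
def IsDefect (σ : DiluteLink N) (i : Fin N) : Prop := σ.slot i = .defect

/-- Being a defect is decidable. [folklore] -/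
instance (σ : DiluteLink N) (i : Fin N) : Decidable (σ.IsDefect i) :=
  inferInstanceAs (Decidable (σ.slot i = .defect))

/-- The set of occupied nodes. [folklore] -/
def occSet (σ : DiluteLink N) : Finset (Fin N) := univ.filter fun i => σ.occ i

/-- The set of defect nodes. [folklore] -/
def defectSet (σ : DiluteLink N) : Finset (Fin N) := univ.filter fun i => σ.IsDefect i

/-- **The number of defects** `d` of a link state — the sector label (`ℓ` strings in Jacobsen's
terminology; `k` through-lines). [cite: MorinDuchesneKlumperPearce2023, §3.3 (Standard modules)] -/
def defects (σ : DiluteLink N) : ℕ := σ.defectSet.card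

/-- The arcs of a link state, each listed once as an ordered pair `(i, j)` with `i < j`. [folklore] -/
def arcSet (σ : DiluteLink N) : Finset (Fin N × Fin N) :=
  univ.filter fun p => p.1 < p.2 ∧ σ.slot p.1 = .arc p.2

/-- Membership in `occSet`. [folklore] -/
@[simp] theorem mem_occSet {σ : DiluteLink N} {i : Fin N} : i ∈ σ.occSet ↔ σ.occ i := by
  simp [occSet]

/-- Membership in `defectSet`. [folklore] -/
@[simp] theorem mem_defectSet {σ : DiluteLink N} {i : Fin N} : i ∈ σ.defectSet ↔ σ.IsDefect i := by
  simp [defectSet]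

/-- Membership in `arcSet`. [folklore] -/
@[simp] theorem mem_arcSet {σ : DiluteLink N} {p : Fin N × Fin N} :
    p ∈ σ.arcSet ↔ p.1 < p.2 ∧ σ.slot p.1 = .arc p.2 := by
  simp [arcSet]

/-- A defect node is occupied. [folklore] -/
theorem occ_of_isDefect {σ : DiluteLink N} {i : Fin N} (h : σ.IsDefect i) : σ.occ i := by
  rw [IsDefect] at h
  simp [occ, h]

/-- An arc end is occupied. [folklore] -/
theorem occ_of_slot_eq_arc {σ : DiluteLink N} {i j : Fin N} (h : σ.slot i = .arc j) : σ.occ i := by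
  simp [occ, h]

/-- The two ends of an arc are distinct. [folklore] -/
theorem ne_of_slot_eq_arc {σ : DiluteLink N} {i j : Fin N} (h : σ.slot i = .arc j) : i ≠ j := by
  rintro rfl
  exact σ.irrefl i h

/-- The number of defects is at most the number of nodes. [folklore] -/
theorem defects_le (σ : DiluteLink N) : σ.defects ≤ N := by
  simpa [defects] using (card_le_univ σ.defectSet)

/-! ### Basic link states -/

/-- The vacuum: all nodes vacant (`d = 0`). [cite: MorinDuchesneKlumperPearce2023, §3.3] -/
def vacuum (N : ℕ) : DiluteLink N where
  slot _ := .vac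
  symm := by intro i j h; cases h
  irrefl := by intro i h; cases h
  planar := by intro i j h; cases h

/-- The fully packed defect state: every node carries a defect (`d = N`). [cite: MorinDuchesneKlumperPearce2023, §3.3] -/
def full (N : ℕ) : DiluteLink N where
  slot _ := .defect
  symm := by intro i j h; cases h
  irrefl := by intro i h; cases h
  planar := by intro i j h; cases h

/-- One defect at node `i`, all other nodes vacant (`d = 1`: the one-string / polymer sector states
without arcs). [cite: MorinDuchesneKlumperPearce2023, §3.3] -/
def single (i : Fin N) : DiluteLink N where
  slot k := if k = i then .defect else .vac
  symm := by intro k l h; by_cases hk : k = i <;> simp [hk] at h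
  irrefl := by intro k h; by_cases hk : k = i <;> simp [hk] at h
  planar := by intro k l h; by_cases hk : k = i <;> simp [hk] at h

/-- The link states form an inhabited type. [folklore] -/
instance : Inhabited (DiluteLink N) := ⟨vacuum N⟩

/-- Slots of the vacuum. [folklore] -/
@[simp] theorem vacuum_slot (i : Fin N) : (vacuum N).slot i = .vac := rfl
/-- Slots of the full defect state. [folklore] -/
@[simp] theorem full_slot (i : Fin N) : (full N).slot i = .defect := rfl
/-- Slots of a single-defect state. [folklore] -/
@[simp] theorem single_slot (i k : Fin N) :
    (single i).slot k = if k = i then .defect else .vac := rfl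

/-- No node of the vacuum is occupied. [folklore] -/
@[simp] theorem not_occ_vacuum (i : Fin N) : ¬ (vacuum N).occ i := by simp [occ]

/-- No node of the vacuum is a defect. [folklore] -/
@[simp] theorem not_isDefect_vacuum (i : Fin N) : ¬ (vacuum N).IsDefect i := by simp [IsDefect]

/-- The vacuum has no arcs. [folklore] -/
@[simp] theorem arcSet_vacuum : (vacuum N).arcSet = ∅ := by
  ext p; simp [arcSet]

/-- The vacuum has no defects. [folklore] -/
@[simp] theorem defects_vacuum : (vacuum N).defects = 0 := by
  simp [defects, defectSet, IsDefect]

/-- The full defect state has `N` defects. [folklore] -/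
@[simp] theorem defects_full : (full N).defects = N := by
  simp [defects, defectSet, IsDefect]

/-- A single-defect state has one defect. [folklore] -/
@[simp] theorem defects_single (i : Fin N) : (single i).defects = 1 := by
  have : (single i).defectSet = {i} := by
    ext k; by_cases hk : k = i <;> simp [defectSet, IsDefect, hk]
  simp [defects, this]

/-! ### Sectors -/

/-- **The `k`-defect sector**: link states on `N` nodes with exactly `k` defects (the basis of the
standard module `V_{N,k}`; the index type of the `k`-th diagonal block of a defect-preserving
transfer matrix). [cite: MorinDuchesneKlumperPearce2023, §3.3 (Standard modules)] -/
abbrev Sector (N k : ℕ) : Type := {σ : DiluteLink N // σ.defects = k}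

/-- The vacuum lies in sector `0`. [folklore] -/
def Sector.vacuum (N : ℕ) : Sector N 0 := ⟨DiluteLink.vacuum N, defects_vacuum⟩

/-- A single defect lies in sector `1`. [folklore] -/
def Sector.single (i : Fin N) : Sector N 1 := ⟨DiluteLink.single i, defects_single i⟩

/-! ### Dense link patterns are dilute link states -/

/-- A dense non-crossing perfect matching (`TemperleyLieb.LinkPattern`, every node the end of an
arc) is a dilute link state with no vacancy and no defect. [cite: PearceRittenbergDeGierNienhuis2002, §2] -/
def ofLinkPattern (p : TemperleyLieb.LinkPattern N) : DiluteLink N where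
  slot i := .arc (p.1.partner i)
  symm := by
    intro i j h
    simp only [LinkSlot.arc.injEq] at h ⊢
    rw [← h, p.1.partner_partner]
  irrefl := by
    intro i h
    simp only [LinkSlot.arc.injEq] at h
    exact p.1.partner_ne i h
  planar := by
    intro i j h hij k hik hkj
    simp only [LinkSlot.arc.injEq] at h
    subst h
    refine ⟨by simp, ?_⟩
    intro l hl
    simp only [LinkSlot.arc.injEq] at hl
    subst hl
    exact p.2 i k hij hik hkj

/-- Every node of a dense link pattern is occupied. [folklore] -/
theorem occ_ofLinkPattern (p : TemperleyLieb.LinkPattern N) (i : Fin N) : (ofLinkPattern p).occ i := by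
  simp [occ, ofLinkPattern]

/-- A dense link pattern has no defects. [folklore] -/
@[simp] theorem defects_ofLinkPattern (p : TemperleyLieb.LinkPattern N) : (ofLinkPattern p).defects = 0 := by
  simp [defects, defectSet, IsDefect, ofLinkPattern]

end DiluteLink

end Literature.Probability.LatticeModels
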